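import Mathlib

set_option linter.dupNamespace false

/-!
# Lemma L(i) of memo `CuspidalDescentRigidity-g41.md` — kernel-checked abstract core

Seat bsd-idea-20 g41 (planner, lens = mechanism), crux `EllipticUnitValueSevenOfGZK`
(stmt-BirchSwinnertonDyer-19945).  PAPER CLAIM (memo §2, Lemma L(i)): in a hyperbolic plane
`P = f ⊕ t` over `R = ℤ/p^k` (`p` odd) with the symmetric pairing `⟨x e_f + y e_t, x' e_f + y' e_t⟩ = u (x y' + x' y)`,
every isotropic submodule of length `k` is RECTANGULAR: `A = p^a f ⊕ p^(k-a) t`.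
Here this is proved for `R × R`, `R = ZMod (p^k)`, pairing `v.1 * w.2 + w.1 * v.2`
(the unit `u` is irrelevant), `A` any additive subgroup (= submodule) with `A` isotropic and
`Nat.card A = p^k`.  Consequence used in the memo: an `F_ℓ`-stable Lagrangian of
`H¹(K″_λ, E[7^k]) = P₊ ⊕ P₋` meets `H¹_f ⊕ H¹_tr` rectangularly, i.e. Howard's `δ` (Lemma 2.5.7) is `0`.
No summit statement is proved here; this file is a certificate for one linear-algebra lemma.
-/

namespace Summit.BirchSwinnertonDyer.BirchSwinnertonDyer.Cruxes.EllipticUnitValueSevenOfGZK.LemmaL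

open Classical

/-- membership in `zmultiples m` is divisibility by `m` in `ZMod n`. -/
theorem mem_zmultiples_iff_dvd {n : ℕ} (m x : ZMod n) :
    x ∈ AddSubgroup.zmultiples m ↔ m ∣ x := by
  rw [AddSubgroup.mem_zmultiples_iff]
  constructor
  · rintro ⟨z, rfl⟩
    exact ⟨(z : ZMod n), by rw [zsmul_eq_mul, mul_comm]⟩
  · rintro ⟨c, rfl⟩
    obtain ⟨z, rfl⟩ := ZMod.intCast_surjective c
    exact ⟨z, by rw [zsmul_eq_mul, mul_comm]⟩

/-- divisibility by a divisor `m` of the modulus, read on `val`. -/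
theorem natCast_dvd_iff_dvd_val {n m : ℕ} [NeZero n] (hmn : m ∣ n) (x : ZMod n) :
    ((m : ℕ) : ZMod n) ∣ x ↔ m ∣ x.val := by
  constructor
  · rintro ⟨y, hy⟩
    have hv : x.val = ((m : ZMod n) * y).val := by rw [hy]
    rw [ZMod.val_mul, ZMod.val_natCast] at hv
    rw [hv]
    exact (Nat.dvd_mod_iff hmn).2 (dvd_mul_of_dvd_left ((Nat.dvd_mod_iff hmn).2 dvd_rfl) _)
  · rintro ⟨c, hc⟩
    refine ⟨(c : ZMod n), ?_⟩
    calc x = ((x.val : ℕ) : ZMod n) := (ZMod.natCast_zmod_val x).symm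
      _ = ((m * c : ℕ) : ZMod n) := by rw [hc]
      _ = (m : ZMod n) * (c : ZMod n) := by push_cast; ring

/-- the key local step: if `p^a ∣ x`, `p^(a+1) ∤ x` and `x * y = 0` in `ZMod (p^k)`, then `p^(k-a) ∣ y`. -/
theorem dvd_of_mul_eq_zero {p k a : ℕ} [hp : Fact p.Prime] (hak : a < k) (x y : ZMod (p ^ k))
    (hx : ((p ^ a : ℕ) : ZMod (p ^ k)) ∣ x) (hx' : ¬ ((p ^ (a + 1) : ℕ) : ZMod (p ^ k)) ∣ x)
    (hxy : x * y = 0) : ((p ^ (k - a) : ℕ) : ZMod (p ^ k)) ∣ y := by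
  haveI : NeZero (p ^ k) := ⟨(pow_pos hp.out.pos k).ne'⟩
  rw [natCast_dvd_iff_dvd_val (Nat.pow_dvd_pow p hak.le)] at hx
  rw [natCast_dvd_iff_dvd_val (Nat.pow_dvd_pow p (Nat.succ_le_of_lt hak))] at hx'
  rw [natCast_dvd_iff_dvd_val (Nat.pow_dvd_pow p (Nat.sub_le k a))]
  have hk : p ^ k ∣ x.val * y.val := by
    rw [← ZMod.natCast_eq_zero_iff]
    push_cast
    rw [ZMod.natCast_zmod_val, ZMod.natCast_zmod_val, hxy]
  obtain ⟨m, hm⟩ := hx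
  have hpm : ¬ p ∣ m := by
    rintro ⟨c, hc⟩
    exact hx' ⟨c, by rw [hm, hc, pow_succ]; ring⟩
  have h1 : p ^ (k - a) ∣ y.val * m := by
    apply Nat.dvd_of_mul_dvd_mul_left (pow_pos hp.out.pos a)
    rw [← pow_add, Nat.add_sub_cancel' hak.le]
    have : p ^ a * (y.val * m) = x.val * y.val := by rw [hm]; ring
    rw [this]
    exact hk
  exact (Nat.Coprime.pow_left (k - a) ((Nat.Prime.coprime_iff_not_dvd hp.out).2 hpm)).dvd_of_dvd_mul_right h1

/-- `2` is a unit in `ZMod (p^k)` for an odd prime `p`. -/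
theorem isUnit_two {p k : ℕ} [hp : Fact p.Prime] (hp2 : p ≠ 2) : IsUnit (2 : ZMod (p ^ k)) := by
  have h : ((2 : ℕ) : ZMod (p ^ k)) = 2 := by norm_num
  rw [← h, ZMod.isUnit_iff_coprime]
  exact Nat.Coprime.pow_right _ ((Nat.coprime_primes Nat.prime_two hp.out).2 hp2.symm)

/-- the number of multiples of `p^e` in `ZMod (p^k)` is `p^(k-e)` (`e ≤ k`). -/
theorem card_zmultiples_pow {p k e : ℕ} [hp : Fact p.Prime] (he : e ≤ k) :
    Nat.card (AddSubgroup.zmultiples (((p ^ e : ℕ)) : ZMod (p ^ k))) = p ^ (k - e) := by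
  rw [Nat.card_zmultiples, ZMod.addOrderOf_coe _ (pow_pos hp.out.pos k).ne',
    Nat.gcd_eq_right (Nat.pow_dvd_pow p he), Nat.pow_div he hp.out.pos]

/-- core of Lemma L(i): an ISOTROPIC subgroup of the hyperbolic plane `ZMod (p^k) × ZMod (p^k)` (`p` odd)
sits inside a rectangle `p^a R × p^(k-a) R`, which has order `p^k`. -/
theorem isotropic_le_rect {p k : ℕ} [hp : Fact p.Prime] (hp2 : p ≠ 2)
    (A : AddSubgroup (ZMod (p ^ k) × ZMod (p ^ k)))
    (hiso : ∀ v ∈ A, ∀ w ∈ A, v.1 * w.2 + w.1 * v.2 = 0) :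
    ∃ a ≤ k, ∃ B : AddSubgroup (ZMod (p ^ k) × ZMod (p ^ k)), A ≤ B ∧ Nat.card B = p ^ k ∧
      ∀ v : ZMod (p ^ k) × ZMod (p ^ k),
        v ∈ B ↔ (((p ^ a : ℕ) : ZMod (p ^ k)) ∣ v.1 ∧ ((p ^ (k - a) : ℕ) : ZMod (p ^ k)) ∣ v.2) := by
  haveI : NeZero (p ^ k) := ⟨(pow_pos hp.out.pos k).ne'⟩
  let P : ℕ → Prop := fun e => ∀ v ∈ A, ((p ^ e : ℕ) : ZMod (p ^ k)) ∣ v.1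
  have hP0 : P 0 := fun v _ => by simp
  have hPa : P (Nat.findGreatest P k) := Nat.findGreatest_spec (P := P) (Nat.zero_le k) hP0
  have ha_le : Nat.findGreatest P k ≤ k := Nat.findGreatest_le k
  set a := Nat.findGreatest P k with ha_def
  let B : AddSubgroup (ZMod (p ^ k) × ZMod (p ^ k)) :=
    (AddSubgroup.zmultiples (((p ^ a : ℕ)) : ZMod (p ^ k))).prod
      (AddSubgroup.zmultiples (((p ^ (k - a) : ℕ)) : ZMod (p ^ k)))
  have hmemB : ∀ v : ZMod (p ^ k) × ZMod (p ^ k),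
      v ∈ B ↔ (((p ^ a : ℕ) : ZMod (p ^ k)) ∣ v.1 ∧ ((p ^ (k - a) : ℕ) : ZMod (p ^ k)) ∣ v.2) := by
    intro v
    simp only [B, AddSubgroup.mem_prod, mem_zmultiples_iff_dvd]
  have hAB : A ≤ B := by
    intro w hw
    rw [hmemB]
    refine ⟨hPa w hw, ?_⟩
    by_cases hak : a = k
    · rw [hak, Nat.sub_self, pow_zero, Nat.cast_one]
      exact one_dvd _
    · have hak' : a < k := lt_of_le_of_ne ha_le hak
      have hnot : ¬ P (a + 1) := Nat.findGreatest_is_greatest (Nat.lt_succ_self a) hak'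
      simp only [P, not_forall, exists_prop] at hnot
      obtain ⟨v₀, hv₀, hnd⟩ := hnot
      have h1 : ((p ^ a : ℕ) : ZMod (p ^ k)) ∣ v₀.1 := hPa v₀ hv₀
      have hvv : v₀.1 * v₀.2 = 0 := by
        have h2 : (2 : ZMod (p ^ k)) * (v₀.1 * v₀.2) = 0 := by
          rw [two_mul]; exact hiso v₀ hv₀ v₀ hv₀
        exact ((isUnit_two (k := k) hp2).mul_right_eq_zero).1 h2
      have hv02 : ((p ^ (k - a) : ℕ) : ZMod (p ^ k)) ∣ v₀.2 := dvd_of_mul_eq_zero hak' _ _ h1 hnd hvv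
      have hw1 : ((p ^ a : ℕ) : ZMod (p ^ k)) ∣ w.1 := hPa w hw
      have hcross := hiso v₀ hv₀ w hw
      have hzero : w.1 * v₀.2 = 0 := by
        obtain ⟨s, hs⟩ := hw1
        obtain ⟨t, ht⟩ := hv02
        have hpp : ((p ^ a : ℕ) : ZMod (p ^ k)) * ((p ^ (k - a) : ℕ) : ZMod (p ^ k)) = 0 := by
          rw [← Nat.cast_mul, ← pow_add, Nat.add_sub_cancel' ha_le]
          exact ZMod.natCast_self (p ^ k)
        rw [hs, ht]
        calc ((p ^ a : ℕ) : ZMod (p ^ k)) * s * (((p ^ (k - a) : ℕ) : ZMod (p ^ k)) * t)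
            = (((p ^ a : ℕ) : ZMod (p ^ k)) * ((p ^ (k - a) : ℕ) : ZMod (p ^ k))) * (s * t) := by ring
          _ = 0 := by rw [hpp, zero_mul]
      have hv0w : v₀.1 * w.2 = 0 := by rwa [hzero, add_zero] at hcross
      exact dvd_of_mul_eq_zero hak' _ _ h1 hnd hv0w
  have hcardB : Nat.card B = p ^ k := by
    rw [Nat.card_congr (AddSubgroup.prodEquiv _ _).toEquiv, Nat.card_prod,
      card_zmultiples_pow ha_le, card_zmultiples_pow (Nat.sub_le k a), Nat.sub_sub_self ha_le,
      ← pow_add, Nat.sub_add_cancel ha_le]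
  exact ⟨a, ha_le, B, hAB, hcardB, hmemB⟩

/-- an isotropic subgroup of the hyperbolic plane has order at most `p^k`. -/
theorem isotropic_card_le {p k : ℕ} [hp : Fact p.Prime] (hp2 : p ≠ 2)
    (A : AddSubgroup (ZMod (p ^ k) × ZMod (p ^ k)))
    (hiso : ∀ v ∈ A, ∀ w ∈ A, v.1 * w.2 + w.1 * v.2 = 0) : Nat.card A ≤ p ^ k := by
  haveI : NeZero (p ^ k) := ⟨(pow_pos hp.out.pos k).ne'⟩
  obtain ⟨a, _, B, hAB, hcardB, _⟩ := isotropic_le_rect hp2 A hiso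
  exact (AddSubgroup.card_le_of_le hAB).trans hcardB.le

/-- **Lemma L(i)** (memo `CuspidalDescentRigidity-g41.md` §2): a Lagrangian (isotropic, of order `p^k`)
subgroup of the hyperbolic plane `ZMod (p^k) × ZMod (p^k)`, `p` odd, is RECTANGULAR `p^a R × p^(k-a) R`. -/
theorem lagrangian_rectangular {p k : ℕ} [hp : Fact p.Prime] (hp2 : p ≠ 2)
    (A : AddSubgroup (ZMod (p ^ k) × ZMod (p ^ k)))
    (hiso : ∀ v ∈ A, ∀ w ∈ A, v.1 * w.2 + w.1 * v.2 = 0)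
    (hcard : Nat.card A = p ^ k) :
    ∃ a ≤ k, ∀ v : ZMod (p ^ k) × ZMod (p ^ k),
      v ∈ A ↔ (((p ^ a : ℕ) : ZMod (p ^ k)) ∣ v.1 ∧ ((p ^ (k - a) : ℕ) : ZMod (p ^ k)) ∣ v.2) := by
  haveI : NeZero (p ^ k) := ⟨(pow_pos hp.out.pos k).ne'⟩
  obtain ⟨a, ha_le, B, hAB, hcardB, hmemB⟩ := isotropic_le_rect hp2 A hiso
  have hAeqB : A = B := AddSubgroup.eq_of_le_of_card_ge hAB (by rw [hcard, hcardB])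
  refine ⟨a, ha_le, fun v => ?_⟩
  rw [← hmemB, hAeqB]

/-- arithmetic: two numbers `≤ n` with product `n * n` (`n > 0`) are both `n`. -/
theorem eq_of_le_of_mul_eq {a b n : ℕ} (ha : a ≤ n) (hb : b ≤ n) (hn : 0 < n) (h : a * b = n * n) :
    a = n ∧ b = n := by
  constructor
  · by_contra hne
    have hlt : a < n := lt_of_le_of_ne ha hne
    nlinarith [Nat.mul_le_mul_left a hb]
  · by_contra hne
    have hlt : b < n := lt_of_le_of_ne hb hne
    nlinarith [Nat.mul_le_mul_right b ha]

/-- **Lemma L(ii), algebraic content** (memo §2): in the orthogonal sum `P₊ ⊕ P₋` of two hyperbolic planes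
(`ZMod (p^k) × ZMod (p^k)` each, pairing `v.1 w.2 + w.1 v.2` on each plane), a Lagrangian subgroup `A`
(isotropic, order `p^(2k)`) which is stable under the involution `F = (+1) ⊕ (−1)` is the product of two
RECTANGLES; in particular `A = A_f + A_tr` with `A_f = A ∩ (first coordinates)`, `A_tr = A ∩ (second
coordinates)` — Howard's `δ` (Lemma 2.5.7) vanishes for `F_ℓ`-stable Lagrangians. -/
theorem stable_lagrangian_rectangular {p k : ℕ} [hp : Fact p.Prime] (hp2 : p ≠ 2)
    (A : AddSubgroup ((ZMod (p ^ k) × ZMod (p ^ k)) × (ZMod (p ^ k) × ZMod (p ^ k))))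
    (hF : ∀ x ∈ A, (x.1, -x.2) ∈ A)
    (hiso : ∀ x ∈ A, ∀ y ∈ A,
      (x.1.1 * y.1.2 + y.1.1 * x.1.2) + (x.2.1 * y.2.2 + y.2.1 * x.2.2) = 0)
    (hcard : Nat.card A = p ^ k * p ^ k) :
    ∃ a ≤ k, ∃ b ≤ k, ∀ x : (ZMod (p ^ k) × ZMod (p ^ k)) × (ZMod (p ^ k) × ZMod (p ^ k)),
      x ∈ A ↔
        ((((p ^ a : ℕ) : ZMod (p ^ k)) ∣ x.1.1 ∧ ((p ^ (k - a) : ℕ) : ZMod (p ^ k)) ∣ x.1.2) ∧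
         (((p ^ b : ℕ) : ZMod (p ^ k)) ∣ x.2.1 ∧ ((p ^ (k - b) : ℕ) : ZMod (p ^ k)) ∣ x.2.2)) := by
  haveI : NeZero (p ^ k) := ⟨(pow_pos hp.out.pos k).ne'⟩
  -- (1) F-stability and 2 ∈ R^× split A as A₊ × A₋
  obtain ⟨w, hw⟩ := (isUnit_two (k := k) hp2).exists_left_inv
  have hw2 : ∀ t : ZMod (p ^ k), w * (t + t) = t := fun t => by
    rw [← two_mul, ← mul_assoc, hw, one_mul]
  have hw2' : ∀ t : ZMod (p ^ k), w * t + w * t = t := fun t => by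
    rw [← mul_add, hw2]
  have hsmul : ∀ y : (ZMod (p ^ k) × ZMod (p ^ k)) × (ZMod (p ^ k) × ZMod (p ^ k)),
      y ∈ A → w • y ∈ A := by
    intro y hy
    have : w • y = w.val • y := by
      rw [← Nat.cast_smul_eq_nsmul (ZMod (p ^ k)) w.val y, ZMod.natCast_zmod_val]
    rw [this]
    exact A.nsmul_mem hy _
  have hsplit : ∀ x ∈ A,
      ((x.1, 0) : (ZMod (p ^ k) × ZMod (p ^ k)) × (ZMod (p ^ k) × ZMod (p ^ k))) ∈ A ∧
      ((0, x.2) : (ZMod (p ^ k) × ZMod (p ^ k)) × (ZMod (p ^ k) × ZMod (p ^ k))) ∈ A := by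
    intro x hx
    have hplus : ((x.1 + x.1, 0) : (ZMod (p ^ k) × ZMod (p ^ k)) × (ZMod (p ^ k) × ZMod (p ^ k))) ∈ A := by
      have h := A.add_mem hx (hF x hx)
      have e : x + (x.1, -x.2) = (x.1 + x.1, 0) := by ext <;> simp
      rw [e] at h
      exact h
    have hminus : ((0, x.2 + x.2) : (ZMod (p ^ k) × ZMod (p ^ k)) × (ZMod (p ^ k) × ZMod (p ^ k))) ∈ A := by
      have h := A.sub_mem hx (hF x hx)
      have e : x - (x.1, -x.2) = (0, x.2 + x.2) := by ext <;> simp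
      rw [e] at h
      exact h
    refine ⟨?_, ?_⟩
    · have h := hsmul _ hplus
      have e : w • ((x.1 + x.1, 0) : (ZMod (p ^ k) × ZMod (p ^ k)) × (ZMod (p ^ k) × ZMod (p ^ k)))
          = (x.1, 0) := by ext <;> simp [hw2']
      rw [e] at h
      exact h
    · have h := hsmul _ hminus
      have e : w • ((0, x.2 + x.2) : (ZMod (p ^ k) × ZMod (p ^ k)) × (ZMod (p ^ k) × ZMod (p ^ k)))
          = (0, x.2) := by ext <;> simp [hw2']
      rw [e] at h
      exact h
  -- (2) the two slices
  let Ap : AddSubgroup (ZMod (p ^ k) × ZMod (p ^ k)) :=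
    A.comap (AddMonoidHom.inl (ZMod (p ^ k) × ZMod (p ^ k)) (ZMod (p ^ k) × ZMod (p ^ k)))
  let Am : AddSubgroup (ZMod (p ^ k) × ZMod (p ^ k)) :=
    A.comap (AddMonoidHom.inr (ZMod (p ^ k) × ZMod (p ^ k)) (ZMod (p ^ k) × ZMod (p ^ k)))
  have hmemAp : ∀ v, v ∈ Ap ↔ ((v, 0) : (ZMod (p ^ k) × ZMod (p ^ k)) × (ZMod (p ^ k) × ZMod (p ^ k))) ∈ A := by
    intro v; simp only [Ap, AddSubgroup.mem_comap, AddMonoidHom.inl_apply]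
  have hmemAm : ∀ v, v ∈ Am ↔ ((0, v) : (ZMod (p ^ k) × ZMod (p ^ k)) × (ZMod (p ^ k) × ZMod (p ^ k))) ∈ A := by
    intro v; simp only [Am, AddSubgroup.mem_comap, AddMonoidHom.inr_apply]
  have hisoP : ∀ v ∈ Ap, ∀ v' ∈ Ap, v.1 * v'.2 + v'.1 * v.2 = 0 := by
    intro v hv v' hv'
    rw [hmemAp] at hv hv'
    have h := hiso _ hv _ hv'
    simpa using h
  have hisoM : ∀ v ∈ Am, ∀ v' ∈ Am, v.1 * v'.2 + v'.1 * v.2 = 0 := by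
    intro v hv v' hv'
    rw [hmemAm] at hv hv'
    have h := hiso _ hv _ hv'
    simpa using h
  -- (3) A = Ap × Am, so the orders multiply
  have hAeq : A = Ap.prod Am := by
    ext x
    rw [AddSubgroup.mem_prod, hmemAp, hmemAm]
    constructor
    · intro hx; exact hsplit x hx
    · rintro ⟨h1, h2⟩
      have h := A.add_mem h1 h2
      have e : ((x.1, 0) : (ZMod (p ^ k) × ZMod (p ^ k)) × (ZMod (p ^ k) × ZMod (p ^ k))) + (0, x.2) = x := by
        ext <;> simp
      rw [e] at h
      exact h
  have hcard2 : Nat.card Ap * Nat.card Am = p ^ k * p ^ k := by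
    rw [← hcard, hAeq, Nat.card_congr (AddSubgroup.prodEquiv _ _).toEquiv, Nat.card_prod]
  obtain ⟨hcP, hcM⟩ := eq_of_le_of_mul_eq (isotropic_card_le hp2 Ap hisoP) (isotropic_card_le hp2 Am hisoM)
    (pow_pos hp.out.pos k) hcard2
  -- (4) each slice is a Lagrangian of its plane, hence rectangular
  obtain ⟨a, ha, hrectP⟩ := lagrangian_rectangular hp2 Ap hisoP hcP
  obtain ⟨b, hb, hrectM⟩ := lagrangian_rectangular hp2 Am hisoM hcM
  refine ⟨a, ha, b, hb, fun x => ?_⟩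
  rw [hAeq, AddSubgroup.mem_prod, hrectP, hrectM]

/-- Howard's `δ = 0` for `F`-stable Lagrangians: `A` is generated by its finite part (first coordinates of
both planes) and its transverse part (second coordinates). -/
theorem stable_lagrangian_delta_zero {p k : ℕ} [hp : Fact p.Prime] (hp2 : p ≠ 2)
    (A : AddSubgroup ((ZMod (p ^ k) × ZMod (p ^ k)) × (ZMod (p ^ k) × ZMod (p ^ k))))
    (hF : ∀ x ∈ A, (x.1, -x.2) ∈ A)
    (hiso : ∀ x ∈ A, ∀ y ∈ A,
      (x.1.1 * y.1.2 + y.1.1 * x.1.2) + (x.2.1 * y.2.2 + y.2.1 * x.2.2) = 0)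
    (hcard : Nat.card A = p ^ k * p ^ k) :
    ∀ x ∈ A,
      (((x.1.1, 0), (x.2.1, 0)) : (ZMod (p ^ k) × ZMod (p ^ k)) × (ZMod (p ^ k) × ZMod (p ^ k))) ∈ A ∧
      (((0, x.1.2), (0, x.2.2)) : (ZMod (p ^ k) × ZMod (p ^ k)) × (ZMod (p ^ k) × ZMod (p ^ k))) ∈ A := by
  obtain ⟨a, _, b, _, hrect⟩ := stable_lagrangian_rectangular hp2 A hF hiso hcard
  intro x hx
  have h := (hrect x).1 hx
  refine ⟨(hrect _).2 ?_, (hrect _).2 ?_⟩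
  · exact ⟨⟨h.1.1, dvd_zero _⟩, ⟨h.2.1, dvd_zero _⟩⟩
  · exact ⟨⟨dvd_zero _, h.1.2⟩, ⟨dvd_zero _, h.2.2⟩⟩

end Summit.BirchSwinnertonDyer.BirchSwinnertonDyer.Cruxes.EllipticUnitValueSevenOfGZK.LemmaL
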